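import Summits.NavierStokesRegularity.NavierStokesRegularity.Theorems.OddMorawetzLocal.Negative.OddMorawetzLocalRefutationData5
import Summits.NavierStokesRegularity.NavierStokesRegularity.Theorems.OddMorawetzLocal.Negative.OddMorawetzLocalRefutationDefsV
import HarnessLib

/-!
# Crux `OddMorawetzLocal` (stmt-NavierStokesRegularity-1376) — kernel certificates, weight 5 (part C1)

The finite computations of the weight-5 half of the refutation, each a closed Boolean evaluated by the kernel
(`decide +kernel`) on the vocabulary of `OddMorawetzLocalJetAlgebra` / `…RefutationDefs{,Fast,IV,V}` and the literal
data of `…RefutationData5`.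
Parts C1–C3: `cert5_iso_der_*` — every isotropic basis polynomial is killed by the derivation `der lieZ`.
Chunks of two descriptors per theorem (kernel memory). No analysis; lands `--supports` the crux item.
-/

set_option linter.dupNamespace false

namespace Summit.NavierStokesRegularity.NavierStokesRegularity.Theorems.OddMorawetz

/-- Isotropic basis elements `0`, `1`: killed by the derivation `der lieZ`. -/
theorem cert5_iso_der_0 : (((isoDesc5.drop 0).take 2).all fun d => derKillsF lieZ (isoPolyF d)) = true := by
  decide +kernel

/-- Isotropic basis elements `2`, `3`: killed by the derivation `der lieZ`. -/
theorem cert5_iso_der_1 : (((isoDesc5.drop 2).take 2).all fun d => derKillsF lieZ (isoPolyF d)) = true := by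
  decide +kernel

/-- Isotropic basis elements `4`, `5`: killed by the derivation `der lieZ`. -/
theorem cert5_iso_der_2 : (((isoDesc5.drop 4).take 2).all fun d => derKillsF lieZ (isoPolyF d)) = true := by
  decide +kernel

/-- Isotropic basis elements `6`, `7`: killed by the derivation `der lieZ`. -/
theorem cert5_iso_der_3 : (((isoDesc5.drop 6).take 2).all fun d => derKillsF lieZ (isoPolyF d)) = true := by
  decide +kernel

/-- Isotropic basis elements `8`, `9`: killed by the derivation `der lieZ`. -/
theorem cert5_iso_der_4 : (((isoDesc5.drop 8).take 2).all fun d => derKillsF lieZ (isoPolyF d)) = true := by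
  decide +kernel

/-- Isotropic basis elements `10`, `11`: killed by the derivation `der lieZ`. -/
theorem cert5_iso_der_5 : (((isoDesc5.drop 10).take 2).all fun d => derKillsF lieZ (isoPolyF d)) = true := by
  decide +kernel

/-- Isotropic basis elements `12`, `13`: killed by the derivation `der lieZ`. -/
theorem cert5_iso_der_6 : (((isoDesc5.drop 12).take 2).all fun d => derKillsF lieZ (isoPolyF d)) = true := by
  decide +kernel

/-- Isotropic basis elements `14`, `15`: killed by the derivation `der lieZ`. -/
theorem cert5_iso_der_7 : (((isoDesc5.drop 14).take 2).all fun d => derKillsF lieZ (isoPolyF d)) = true := by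
  decide +kernel

/-- Isotropic basis elements `16`, `17`: killed by the derivation `der lieZ`. -/
theorem cert5_iso_der_8 : (((isoDesc5.drop 16).take 2).all fun d => derKillsF lieZ (isoPolyF d)) = true := by
  decide +kernel

end Summit.NavierStokesRegularity.NavierStokesRegularity.Theorems.OddMorawetz
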